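import Summits.QuantumAdvantage.AdviceFreeQNC0.WalkPolynomialTransforms
import Literature.Computability.MetaComplexity.LowDegreeClosure
import HarnessLib

/-!
# Cell qa-qnc0 (rung F-Q1, route RingFrame, crux α `RingToElim`): FAIL SETS HIT EVERY LOW-DEGREE
# POLYNOMIAL — the fail set of a degree-`D` strategy on `m ≥ 2D + 4D' + 3` bits is an
# interpolating set for degree `D'`, hence has `≥ Σ_{j ≤ D'} C(m, j)` points (planner qa-qnc0-p1
# TARGET §15.4(b) `FailSetHits`, all `D, D'`)

Planner qa-qnc0-p1's HITTING corollary of the `𝔽₄`-Hadamard picture (TARGET §15.4(b), typed there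
as `FailSetHits`: "the FAIL set `B` of a degree-`D` full strategy meets `{Q ≠ 0}` for every
non-zero `𝔽₂`-polynomial `Q` of degree `≤ D'`, so `|B| ≥ Σ_{j≤D'} C(n,j)`"), made kernel for all
`D, D'`, every block length `m ≥ 2D + 4D' + 3` and every `ℓ ≥ m`, over the toolkit of
`WalkCharacters.lean` … `WalkPolynomialTransforms.lean` (there: `𝔽₄[u]_{≤D'}·M_D(P) ⊆ M_{D'+D}(P)`;
`Q|_{FAIL} = 0 ⇒ Q = tr(Q·f)` has no far frequencies, `Lfun_algebraMap_eq_zero_of_vanish`; the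
twisted transform of `u^S` is the product `Π_{i∈S} τ_a(i)`, `τ_a(i) = ω^{2aᵢ}`; the flipped
patterns `σ_T alt`, `|T| ≤ D'`, are far, `far_flipOn_alt`):

* `sum_powerset_prod_twist_eq_zero`, `sum_powerset_prod_twist_self` — the MÖBIUS STEP over the
  subcube `{σ_T alt : T ⊆ S₀}` of patterns: the twisted products over `S` cancel in pairs when
  `S ⊉ S₀` (characteristic `2`), and sum to `Π_{i∈S₀}(ω + ω²) = 1` when `S = S₀`;
* **`eq_zero_of_vanish_on_failSet`** — THE INTERPOLATION THEOREM: for `f ∈ M_D(P)` on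
  `m ≥ 2D + 4D' + 3` bits, an `𝔽₂`-polynomial `Q` of degree `≤ D'` vanishing on `{tr f ≠ 1}` is
  zero.  Proof: write `Q = Σ_S q_S u^S`, take `S₀` of maximal size in the support, and sum the
  (vanishing) twisted transforms `ω^{2a([m])} L_a(Q)` over `a = σ_T alt`, `T ⊆ S₀`: every
  `S ≠ S₀` cancels, `S₀` contributes `q_{S₀} = 1`, so `1 = 0`;
* **`numMonomials_le_card_failSet`** — hence `#{tr f ≠ 1} ≥ N_{D'}(m) := Σ_{j≤D'} C(m,j)`
  (`Literature…LowDegreeClosure.card_closure_lt_of_card_lt`, Srinivasan 2023 Remark 3.7, over `𝔽₂`);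
* `ringWinU_failSetHits_append`, **`ringWinU_failSetHits`** — every walk strategy of `𝔽₂`-degree
  `≤ D` on `ℓ ≥ m ≥ 2D + 4D' + 3` bits fails on `≥ 2^{ℓ−m} · N_{D'}(m)` inputs, every charge
  (fibres of the first block are full strategies, `fibre_mem_fullSpan`);
  `card_ringWinU_le_failSetHits` — `#WIN ≤ (1 − N_{D'}(m)/2^m)·2^ℓ`;
* **`mixedHardAt_failSetHits`** — `MixedHardAt ℓ D (1 − N_{D'}(m)/2^m)` for `2D + 4D' + 5 ≤ m ≤ ℓ`
  (even triples are walk strategies of degree `D+1`, `evenTriple_isWalkRow`).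

Numbers (planner qa-qnc0-p1 ROUND-11 §1.1, the DENSITY AXIS `φ(ℓ, D) ≥ 2^{−a·D}`): the fail floor
`ringWinU_fail_floor` (`D' = 0`) has deficit `2D + 3` bits (`a = 2`); here, with `D' ≈ 0.24·D`
and `m = 2D + 4D' + 3`, the deficit `m − log₂ N_{D'}(m)` is `40.1` bits at `D = 20` (`D' = 4`;
floor `43`), `75.7` at `D = 40` (`D' = 9`; floor `83`), `146.6` at `D = 80` (`D' = 19`; floor
`163`), `358.2` at `D = 200` (`D' = 47`; floor `403`); along `D = 4D' → ∞`,
`a → 3·(1 − H(1/12)) ≈ 1.757` (exact binomial sums, prover qn-prover-3 gen 6).  T10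
(`Sketch12.RingFailLinear`) asks for `a < 1`; the prose LP/grid exponent `log₂ 3 ≈ 1.585`
(TARGET §16.0 (iv)) is not formalised.  Ring reading:
`QuantumAdvantage/Theorems/RingFrameRingToElimFailSetHits.lean`.  The cell's theorem (planner
qa-qnc0-p1 gen 3, statement and proof sketch via Srinivasan's Fact 3.4; prover qn-prover-3 gen 6,
kernel proof by the Möbius step, which needs neither `𝔽₄` as a field nor Fact 3.4), 2026-08-27;
not in print.  WHAT THIS IS NOT: an exact-algebra bound with exponent `≈ 1.76`, not `< 1` (it
dies at constant `η` like the fail floor); nothing on α at constant `η`; no separation claim.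
-/

noncomputable section

namespace Summit.QuantumAdvantage.AdviceFreeQNC0

open Finset
open Literature.Computability.MetaComplexity Literature.Computability.MetaComplexity.Smolensky
open F4

variable {m : ℕ}

/-! ### The Möbius step over a subcube of patterns around `alt` -/

/-- Flipping on `insert j T` agrees with flipping on `T` away from `j`. -/
theorem flipOn_insert_of_ne {T : Finset (Fin m)} {i j : Fin m} (hij : i ≠ j) (a : Fin m → Bool) :
    flipOn (insert j T) a i = flipOn T a i := by
  classical
  simp [flipOn, Finset.mem_insert, hij]

/-- **Cancellation**: if `S` misses a point `j` of `S₀`, the twisted products over the subcube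
`{σ_T alt : T ⊆ S₀}` cancel in pairs `T ↔ T ∪ {j}` (characteristic `2`). -/
theorem sum_powerset_prod_twist_eq_zero {S S₀ : Finset (Fin m)} {j : Fin m} (hj : j ∈ S₀) (hjS : j ∉ S)
    (b : Fin m → Bool) :
    ∑ T ∈ S₀.powerset, ∏ i ∈ S, twist (flipOn T b) i = 0 := by
  classical
  have hS₀ : S₀ = insert j (S₀.erase j) := (Finset.insert_erase hj).symm
  rw [hS₀, Finset.sum_powerset_insert (Finset.notMem_erase j S₀)]
  have e : ∀ T ∈ (S₀.erase j).powerset,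
      ∏ i ∈ S, twist (flipOn (insert j T) b) i = ∏ i ∈ S, twist (flipOn T b) i := by
    intro T _
    refine Finset.prod_congr rfl fun i hi => ?_
    have hij : i ≠ j := fun h => hjS (h ▸ hi)
    unfold twist
    rw [flipOn_insert_of_ne hij]
  rw [Finset.sum_congr rfl e, add_self]

/-- **The top term**: over the subcube `{σ_T b : T ⊆ S₀}` the twisted products over `S₀` itself
sum to `Π_{i∈S₀} (ω + ω²) = 1`. -/
theorem sum_powerset_prod_twist_self (S₀ : Finset (Fin m)) (b : Fin m → Bool) :
    ∑ T ∈ S₀.powerset, ∏ i ∈ S₀, twist (flipOn T b) i = 1 := by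
  classical
  have h := Finset.prod_add (fun i => ω ^ (2 * lett (!b i))) (fun i => ω ^ (2 * lett (b i))) S₀
  have hone : ∏ i ∈ S₀, (ω ^ (2 * lett (!b i)) + ω ^ (2 * lett (b i))) = 1 := by
    refine Finset.prod_eq_one fun i _ => ?_
    unfold lett
    cases b i
    · simp only [Bool.not_false, if_true, Bool.false_eq_true, if_false]
      rw [omega_pow_mod (2 * 2), show 2 * 2 % 3 = 1 from rfl, pow_one, show 2 * 1 = 2 from rfl,
        omega_add_omega_sq]
    · simp only [Bool.not_true, Bool.false_eq_true, if_false, if_true]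
      rw [omega_pow_mod (2 * 2), show 2 * 2 % 3 = 1 from rfl, pow_one, show 2 * 1 = 2 from rfl,
        add_comm, omega_add_omega_sq]
  rw [hone] at h
  rw [h]
  refine Finset.sum_congr rfl fun T hT => ?_
  have hTS : T ⊆ S₀ := Finset.mem_powerset.1 hT
  rw [← Finset.prod_sdiff hTS, mul_comm]
  congr 1
  · refine Finset.prod_congr rfl fun i hi => ?_
    unfold twist flipOn
    rw [if_pos hi]
  · refine Finset.prod_congr rfl fun i hi => ?_
    unfold twist flipOn
    rw [if_neg (Finset.mem_sdiff.1 hi).2]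

/-! ### The interpolation theorem -/

/-- The two elements of `𝔽₂`. -/
private theorem zmod2_eq_zero_or_one' (s : ZMod 2) : s = 0 ∨ s = 1 := by
  fin_cases s
  · exact Or.inl rfl
  · exact Or.inr rfl


/-- **FAIL SETS ARE INTERPOLATING SETS** (planner qa-qnc0-p1 TARGET §15.4(b) `FailSetHits`, all
`D, D'`): for `f` in the full module `M_D(P)` on `m ≥ 2D + 4D' + 3` bits, an `𝔽₂`-polynomial of
degree `≤ D'` that vanishes wherever `f` fails (`tr f ≠ 1`) vanishes identically. [folklore] -/
theorem eq_zero_of_vanish_on_failSet {D D' : ℕ} (hm : 2 * D + 4 * D' + 3 ≤ m)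
    {f : (Fin m → Bool) → F4} (hf : f ∈ fullSpan m D) {Q : CubeFn (ZMod 2) m}
    (hQ : Q ∈ lowDeg (ZMod 2) m D') (hvan : ∀ u, tr (f u) ≠ 1 → Q u = 0) : Q = 0 := by
  classical
  haveI := F4.nontrivial
  -- write `Q` in the monomial basis
  have hQ' := hQ
  rw [lowDeg_eq_span] at hQ'
  obtain ⟨c, hc⟩ := Finsupp.mem_span_range_iff_exists_finsupp.1 hQ'
  by_contra hne
  have hc0 : c.support.Nonempty := by
    rw [Finset.nonempty_iff_ne_empty, ne_eq, Finsupp.support_eq_empty]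
    rintro rfl
    apply hne
    rw [← hc]
    simp
  -- a monomial of maximal degree in the support
  obtain ⟨σ₀, hσ₀, hmax⟩ := Finset.exists_max_image c.support (fun σ => σ.1.card) hc0
  set S₀ : Finset (Fin m) := σ₀.1 with hS₀
  have hS₀D : S₀.card ≤ D' := σ₀.2
  -- the twisted transform of `Q` at a pattern `a`
  have hLQ : ∀ a : Fin m → Bool, ω ^ (2 * lettSum univ a) * Lfun a (fun u => algebraMap (ZMod 2) F4 (Q u)) =
      ∑ σ ∈ c.support, algebraMap (ZMod 2) F4 (c σ) * ∏ i ∈ σ.1, twist a i := by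
    intro a
    have eQ : (fun u => algebraMap (ZMod 2) F4 (Q u)) =
        fun u => ∑ σ ∈ c.support, (fun σ u => algebraMap (ZMod 2) F4 (c σ) * monoF σ.1 u) σ u := by
      funext u
      rw [← hc]
      simp only [Finsupp.sum, Finset.sum_apply, Pi.smul_apply, smul_eq_mul, map_sum, map_mul]
      refine Finset.sum_congr rfl fun σ _ => ?_
      congr 1
      unfold mono monoF ιF
      rw [map_prod]
      refine Finset.prod_congr rfl fun i _ => ?_
      by_cases h : u i = true <;> simp [h]
    rw [eQ, Lfun_sum_apply, Finset.mul_sum]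
    refine Finset.sum_congr rfl fun σ _ => ?_
    rw [Lfun_mul_apply a _ (monoF σ.1), mul_left_comm, twist_mul_Lfun_monoF]
  -- it vanishes on the subcube `{σ_T alt : T ⊆ S₀}`
  have hzero : ∀ T ∈ S₀.powerset,
      ∑ σ ∈ c.support, algebraMap (ZMod 2) F4 (c σ) * ∏ i ∈ σ.1, twist (flipOn T alt) i = 0 := by
    intro T hT
    have hTD : T.card ≤ D' := (Finset.card_le_card (Finset.mem_powerset.1 hT)).trans hS₀D
    obtain ⟨hfar, hfar'⟩ := far_flipOn_alt (D := D) hm hTD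
    rw [← hLQ, Lfun_algebraMap_eq_zero_of_vanish hf hQ hvan hfar hfar', mul_zero]
  -- sum over the subcube: only the top monomial survives, with coefficient `1`
  have hsum : ∑ T ∈ S₀.powerset, ∑ σ ∈ c.support,
      algebraMap (ZMod 2) F4 (c σ) * ∏ i ∈ σ.1, twist (flipOn T alt) i = 1 := by
    rw [Finset.sum_comm]
    have inner : ∀ σ ∈ c.support, ∑ T ∈ S₀.powerset,
        algebraMap (ZMod 2) F4 (c σ) * ∏ i ∈ σ.1, twist (flipOn T alt) i =
          if σ = σ₀ then 1 else 0 := by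
      intro σ hσ
      rw [← Finset.mul_sum]
      by_cases hσσ : σ = σ₀
      · rw [if_pos hσσ, hσσ, sum_powerset_prod_twist_self, mul_one]
        have hcσ : c σ₀ ≠ 0 := Finsupp.mem_support_iff.1 hσ₀
        rcases zmod2_eq_zero_or_one' (c σ₀) with h0 | h1
        · exact absurd h0 hcσ
        · rw [h1, map_one]
      · rw [if_neg hσσ]
        -- `S₀ ⊄ σ.1` by maximality, so some `j ∈ S₀ ∖ σ.1`
        have hnot : ¬ S₀ ⊆ σ.1 := by
          intro hsub
          have hle := hmax σ hσ
          have heq : S₀ = σ.1 := Finset.eq_of_subset_of_card_le hsub hle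
          exact hσσ (Subtype.ext heq.symm)
        obtain ⟨j, hj, hjσ⟩ := Finset.not_subset.1 hnot
        rw [sum_powerset_prod_twist_eq_zero hj hjσ, mul_zero]
    rw [Finset.sum_congr rfl inner, Finset.sum_ite_eq' c.support σ₀ fun _ => (1 : F4), if_pos hσ₀]
  rw [Finset.sum_eq_zero hzero] at hsum
  exact zero_ne_one hsum

/-- **The fail set of a full strategy has at least `Σ_{j ≤ D'} C(m, j)` points** (`m ≥ 2D+4D'+3`).
[folklore] -/
theorem numMonomials_le_card_failSet {D D' : ℕ} (hm : 2 * D + 4 * D' + 3 ≤ m)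
    {f : (Fin m → Bool) → F4} (hf : f ∈ fullSpan m D) :
    numMonomials m D' ≤ (univ.filter fun u : Fin m → Bool => tr (f u) ≠ 1).card := by
  classical
  by_contra hlt
  rw [not_le] at hlt
  have h := card_closure_lt_of_card_lt (F := ZMod 2) hlt
  have hne : (closure (ZMod 2) D' (univ.filter fun u : Fin m → Bool => tr (f u) ≠ 1)) ≠ univ := by
    intro h'
    rw [h', Finset.card_univ, Fintype.card_fun, Fintype.card_bool, Fintype.card_fin] at h
    exact lt_irrefl _ h
  obtain ⟨a, -, ha⟩ : ∃ a ∈ (univ : Finset (Fin m → Bool)),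
      a ∉ closure (ZMod 2) D' (univ.filter fun u : Fin m → Bool => tr (f u) ≠ 1) := by
    by_contra h'
    push Not at h'
    exact hne (Finset.eq_univ_of_forall fun a => h' a (Finset.mem_univ a))
  rw [mem_closure] at ha
  push Not at ha
  obtain ⟨Q, hQ, hvan, hQa⟩ := ha
  have hvan' : ∀ u, tr (f u) ≠ 1 → Q u = 0 :=
    fun u hu => hvan u (Finset.mem_filter.2 ⟨Finset.mem_univ u, hu⟩)
  exact hQa (by rw [eq_zero_of_vanish_on_failSet hm hf hQ hvan']; rfl)

/-! ### Fail counts: the walk game and the mixed game -/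

/-- **FAIL-SET HITS, block form.**  A walk strategy of `𝔽₂`-degree `≤ D` on `m + q` bits,
`m ≥ 2D + 4D' + 3`, fails on at least `2^q · Σ_{j ≤ D'} C(m, j)` inputs, for every charge: on each
fibre of the first block the strategy is a full strategy (`fibre_mem_fullSpan`) whose fail set is
an interpolating set for degree `D'` (`numMonomials_le_card_failSet`). [folklore] -/
theorem ringWinU_failSetHits_append (D D' : ℕ) {m : ℕ} (hm : 2 * D + 4 * D' + 3 ≤ m) (q c : ℕ)
    (y : Fin (m + q + 1) → (Fin (m + q) → Bool) → Bool) (hy : ∀ g, HasDeg (y g) D) :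
    2 ^ q * numMonomials m D' ≤
      (univ.filter fun u : Fin (m + q) → Bool => ringWinU c y u = false).card := by
  classical
  -- the fibre fail sets
  have hEb : ∀ b : Fin q → Bool, numMonomials m D' ≤
      (univ.filter fun w : Fin m → Bool => ringWinU c y (Fin.append w b) = false).card := by
    intro b
    have h := numMonomials_le_card_failSet (D := D) (D' := D') hm (fibre_mem_fullSpan c y hy b)
    refine le_trans h (Finset.card_le_card fun w hw => ?_)
    rw [Finset.mem_filter] at hw ⊢
    refine ⟨Finset.mem_univ _, ?_⟩
    have hw' := hw.2
    rw [tr_fibreFun] at hw'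
    cases hwin : ringWinU c y (Fin.append w b)
    · rfl
    · rw [hwin] at hw'
      exact absurd rfl hw'
  -- glue the fibres: `(b, w) ↦ w ++ b` is injective into the fail set
  have hinj : Set.InjOn (fun p : (Σ _ : Fin q → Bool, Fin m → Bool) => Fin.append p.2 p.1)
      (univ.sigma (fun b : Fin q → Bool =>
        univ.filter fun w : Fin m → Bool => ringWinU c y (Fin.append w b) = false) :
          Set (Σ _ : Fin q → Bool, Fin m → Bool)) := by
    rintro ⟨b, w⟩ _ ⟨b', w'⟩ _ h
    have hb : b = b' := by
      funext j
      have := congrFun h (Fin.natAdd m j)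
      simpa only [Fin.append_right] using this
    have hw : w = w' := by
      funext i
      have := congrFun h (Fin.castAdd q i)
      simpa only [Fin.append_left] using this
    subst hb; subst hw; rfl
  have hmaps : ∀ p ∈ univ.sigma (fun b : Fin q → Bool =>
        univ.filter fun w : Fin m → Bool => ringWinU c y (Fin.append w b) = false),
      (fun p : (Σ _ : Fin q → Bool, Fin m → Bool) => Fin.append p.2 p.1) p ∈
        (univ.filter fun u : Fin (m + q) → Bool => ringWinU c y u = false) := by
    rintro ⟨b, w⟩ hp
    rw [Finset.mem_sigma] at hp
    exact Finset.mem_filter.2 ⟨Finset.mem_univ _, (Finset.mem_filter.1 hp.2).2⟩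
  have h := Finset.card_le_card_of_injOn _ hmaps hinj
  rw [Finset.card_sigma] at h
  calc 2 ^ q * numMonomials m D' = ∑ _b : Fin q → Bool, numMonomials m D' := by
        rw [Finset.sum_const, Finset.card_univ, Fintype.card_fun, Fintype.card_bool, Fintype.card_fin,
          smul_eq_mul]
    _ ≤ ∑ b : Fin q → Bool,
          (univ.filter fun w : Fin m → Bool => ringWinU c y (Fin.append w b) = false).card :=
        Finset.sum_le_sum fun b _ => hEb b
    _ ≤ _ := h

/-- **FAIL-SET HITS** (planner qa-qnc0-p1 TARGET §15.4(b), all `D, D'`, all `ℓ`): every walk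
strategy of `𝔽₂`-degree `≤ D` on `ℓ ≥ m ≥ 2D + 4D' + 3` bits fails on at least
`2^{ℓ−m} · Σ_{j ≤ D'} C(m, j)` inputs, for every charge. [folklore] -/
theorem ringWinU_failSetHits (D D' : ℕ) {m ℓ : ℕ} (hm : 2 * D + 4 * D' + 3 ≤ m) (hℓ : m ≤ ℓ) (c : ℕ)
    (y : Fin (ℓ + 1) → (Fin ℓ → Bool) → Bool) (hy : ∀ g, HasDeg (y g) D) :
    2 ^ (ℓ - m) * numMonomials m D' ≤
      (univ.filter fun u : Fin ℓ → Bool => ringWinU c y u = false).card := by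
  obtain ⟨q, rfl⟩ : ∃ q, ℓ = m + q := ⟨ℓ - m, by omega⟩
  rw [show m + q - m = q by omega]
  exact ringWinU_failSetHits_append D D' hm q c y hy

/-- **The win count under the fail-set-hits floor**: `#WIN ≤ (1 − N_{D'}(m)/2^m)·2^ℓ` for every
walk strategy of degree `≤ D` on `ℓ ≥ m ≥ 2D + 4D' + 3` bits. [folklore] -/
theorem card_ringWinU_le_failSetHits (D D' : ℕ) {m ℓ : ℕ} (hm : 2 * D + 4 * D' + 3 ≤ m)
    (hℓ : m ≤ ℓ) (c : ℕ) (y : Fin (ℓ + 1) → (Fin ℓ → Bool) → Bool) (hy : ∀ g, HasDeg (y g) D) :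
    ((univ.filter fun u : Fin ℓ → Bool => ringWinU c y u = true).card : ℝ) ≤
      (1 - (numMonomials m D' : ℝ) / (2 : ℝ) ^ m) * (2 : ℝ) ^ ℓ := by
  have hfl := ringWinU_failSetHits D D' hm hℓ c y hy
  have htot : (univ.filter fun u : Fin ℓ → Bool => ringWinU c y u = true).card +
      (univ.filter fun u : Fin ℓ → Bool => ringWinU c y u = false).card = 2 ^ ℓ := by
    have h := Finset.card_filter_add_card_filter_not
      (s := (univ : Finset (Fin ℓ → Bool))) (fun u => ringWinU c y u = true)
    have hneg : (univ.filter fun u : Fin ℓ → Bool => ¬ ringWinU c y u = true) =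
        univ.filter fun u : Fin ℓ → Bool => ringWinU c y u = false :=
      Finset.filter_congr fun u _ => by simp
    rw [hneg, Finset.card_univ, Fintype.card_fun, Fintype.card_bool, Fintype.card_fin] at h
    exact h
  have hflR : (2 : ℝ) ^ (ℓ - m) * (numMonomials m D' : ℝ) ≤
      ((univ.filter fun u : Fin ℓ → Bool => ringWinU c y u = false).card : ℝ) := by
    exact_mod_cast hfl
  have htotR : ((univ.filter fun u : Fin ℓ → Bool => ringWinU c y u = true).card : ℝ) +
      ((univ.filter fun u : Fin ℓ → Bool => ringWinU c y u = false).card : ℝ) = (2 : ℝ) ^ ℓ := by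
    exact_mod_cast htot
  have hpow : (numMonomials m D' : ℝ) / (2 : ℝ) ^ m * (2 : ℝ) ^ ℓ =
      (2 : ℝ) ^ (ℓ - m) * (numMonomials m D' : ℝ) := by
    have h2 : (2 : ℝ) ^ ℓ = (2 : ℝ) ^ (ℓ - m) * (2 : ℝ) ^ m := by
      rw [← pow_add, Nat.sub_add_cancel hℓ]
    rw [h2]
    field_simp
  rw [sub_mul, one_mul, hpow]
  linarith

/-- **The fail-set-hits floor of the mixed game**: `MixedHardAt ℓ D (1 − N_{D'}(m)/2^m)` for
`2D + 4D' + 5 ≤ m ≤ ℓ` (an even triple of degree `≤ D` is a walk strategy of degree `D+1`,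
`evenTriple_isWalkRow`). [folklore] -/
theorem mixedHardAt_failSetHits (D D' : ℕ) {m ℓ : ℕ} (hm : 2 * D + 4 * D' + 5 ≤ m) (hℓ : m ≤ ℓ) :
    MixedHardAt ℓ D (1 - (numMonomials m D' : ℝ) / (2 : ℝ) ^ m) := by
  intro c P y hPdeg hPeven hy
  have hℓ1 : 1 ≤ ℓ := by omega
  obtain ⟨yP, hyP, hwin⟩ := evenTriple_isWalkRow ℓ hℓ1 c D P ⟨hPdeg, hPeven⟩
  have e : (univ.filter fun w : Fin ℓ → Bool => mixedWinU c P y w = true) =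
      univ.filter fun w : Fin ℓ → Bool => ringWinU c (fun g w => xor (yP g w) (y g w)) w = true := by
    refine Finset.filter_congr fun w _ => ?_
    unfold mixedWinU
    have hw : P (wt w % 3) w = ringWinU c yP w := hwin w
    rw [hw, ringWinU_xor]
  rw [e]
  have hdeg : ∀ g, HasDeg ((fun g w => xor (yP g w) (y g w)) g) (D + 1) := fun g =>
    hasDeg_xor (hyP g) (hasDeg_of_le (hy g) (Nat.le_succ _))
  exact card_ringWinU_le_failSetHits (D + 1) D' (m := m) (by omega) hℓ c _ hdeg
end Summit.QuantumAdvantage.AdviceFreeQNC0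

end
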